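import Mathlib
import HarnessLib
import Literature.Dynamics.Hyperbolic.RGFlowStableManifoldBrouwer

/-!
# The second fixed point of the fine tuning ([ABKM19] Lemma 12.6) for a system parametrised by a
# TUNING PARAMETER `p = q(h)` (a Lipschitz image of the relevant coordinate `h ∈ E_0`)

In [ABKM19] Ch. 12 the renormalisation maps depend on the initial relevant Hamiltonian `ℋ ∈ E_0`
only through the quadratic form `q = q(ℋ)` of the Gaussian measure `μ^{(q)}` (Definition 6.5), a
(real-)linear image of `ℋ`, while the initial activity `y₀ = K̂_0(𝒦, ℋ)` depends on `ℋ` itself.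
`RGFlowStableManifoldBrouwer.exists_isTunedQ_initial_eq_of_finiteDimensional` is Lemma 12.6 for a
system indexed directly by `h ∈ E_0`.  This file is the bookkeeping in between: the steps
`(A^p, B^p, S^p)` are indexed by a parameter `p` of an arbitrary type `Λ` carrying a "distance"
`dist : Λ → Λ → ℝ` and an admissible set `ball ⊆ Λ`; the hypotheses `hT, ha, hb, hl` of Lemma 12.6
are assumed at the PARAMETER level (uniformly on `ball`, Lipschitz in `dist`), and a tuning map
`qmap : E_0 → Λ` sends the `ρ`-ball into `ball` with `dist (qmap h) (qmap h') ≤ L_q ‖h − h'‖`.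

* **`RGFlow.exists_isTunedQ_initial_eq_of_parametrised`** — there is `h⋆`, `‖h⋆‖ ≤ ρ`, and a tuned
  relevant trajectory `x` of the system with parameter `qmap h⋆` and initial activity `y₀ h⋆`, in the
  `ε`-tube, with `x_0 = h⋆` ((12.50)).  `E_0` finite-dimensional (Brouwer); all Lipschitz constants
  arbitrary (they may depend on the volume).

Everything is proved; no named fact.

## References
* S. Adams, S. Buchholz, R. Kotecký, S. Müller, arXiv:1910.13564, Lemma 12.6 and its proof
  (12.50)–(12.56), Definition 6.5 [AdamsBuchholzKoteckyMuller2019].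
-/

noncomputable section

open Set Function Metric Filter
open scoped NNReal Topology

namespace Literature.Dynamics.Hyperbolic

namespace RGFlow

variable {E : ℕ → Type*} [∀ k, NormedAddCommGroup (E k)] [∀ k, NormedSpace ℝ (E k)]
  {F : ℕ → Type*} [∀ k, AddCommGroup (F k)]

section parametrised

variable [∀ k, CompleteSpace (E k)] {N : ℕ} {r α β σ η κ ε ρ a₁ b₁ l₁ m₀ c₀ Lq : ℝ}
  {Q : ∀ k, F k → ℝ → Prop} {Λ : Type*}
  {A : Λ → ∀ k, E k ≃L[ℝ] E (k + 1)} {B : Λ → ∀ k, F k →+ E (k + 1)}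
  {S : Λ → ∀ k, E k → F k → F (k + 1)} {y₀ : E 0 → F 0}

/-- **The second fixed point ([ABKM19] Lemma 12.6) for a system indexed by a tuning parameter.**
`E_0` finite-dimensional; the steps `(A^p, B^p, S^p)`, `p ∈ ball ⊆ Λ`, satisfy `IsRGStepQ N r α β σ Q`
and depend on `p` in a Lipschitz way with respect to `dist` (constants `a₁, b₁, l₁ ≥ 0`, arbitrary):
`‖(A^p_k)⁻¹ − (A^{p'}_k)⁻¹‖ ≤ a₁·dist(p,p')`, `‖(B^p_k − B^{p'}_k) v‖ ≤ b₁·dist(p,p')·‖v‖_k`,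
`‖(S^p_k − S^{p'}_k)(u,v)‖_{k+1} ≤ l₁·dist(p,p')·max(‖u‖, ‖v‖_k)` on the `r`-ball; the initial activity
obeys `‖y₀^h‖_0 ≤ c₀ ≤ ε ≤ ρ` and `‖y₀^h − y₀^{h'}‖_0 ≤ m₀‖h−h'‖`; the tuning map sends the `ρ`-ball into
`ball` with `dist(q(h), q(h')) ≤ L_q‖h − h'‖`; the predicates give nonnegative bounds below the
horizon.  Then there is `h⋆`, `‖h⋆‖ ≤ ρ`, and a tuned relevant trajectory `x` of the system with
parameter `q(h⋆)` and initial activity `y₀^{h⋆}` in the `ε`-tube with `x_0 = h⋆` ((12.50):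
`Π_{H_0} Ẑ(𝒦, ℋ) = ℋ` with the Gaussian `μ^{(q(ℋ))}`). [cite: AdamsBuchholzKoteckyMuller2019, Lemma 12.6] -/
theorem exists_isTunedQ_initial_eq_of_parametrised [FiniteDimensional ℝ (E 0)]
    (dist : Λ → Λ → ℝ) (ball : Set Λ) (qmap : E 0 → Λ)
    (hQ : IsSubaddNormBound Q) (hQnn : ∀ k, k < N → ∀ (v : F k) (c : ℝ), Q k v c → 0 ≤ c)
    (hη : 0 < η) (hη1 : η ≤ 1)
    (hα : 0 ≤ α) (hβ : 0 ≤ β) (hκ₁ : α * (η + β) ≤ κ) (hκ₂ : σ ≤ κ * η)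
    (hκ : κ < 1) (hε : 0 ≤ ε) (hεr : ε ≤ r) (hερ : ε ≤ ρ) (ha1 : 0 ≤ a₁) (hb1 : 0 ≤ b₁)
    (hl1 : 0 ≤ l₁) (hLq : 0 ≤ Lq) (hc₀ : c₀ ≤ ε)
    (hmaps : ∀ h : E 0, ‖h‖ ≤ ρ → qmap h ∈ ball)
    (hlip : ∀ h h' : E 0, ‖h‖ ≤ ρ → ‖h'‖ ≤ ρ → dist (qmap h) (qmap h') ≤ Lq * ‖h - h'‖)
    (hT : ∀ p, p ∈ ball → IsRGStepQ N r α β σ Q (A p) (B p) (S p))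
    (hy₀ : ∀ h : E 0, ‖h‖ ≤ ρ → Q 0 (y₀ h) c₀)
    (ha : ∀ p p', p ∈ ball → p' ∈ ball → ∀ k, k < N → ∀ w : E (k + 1),
      ‖(A p k).symm w - (A p' k).symm w‖ ≤ a₁ * dist p p' * ‖w‖)
    (hb : ∀ p p', p ∈ ball → p' ∈ ball → ∀ k, k < N → ∀ (v : F k) (c : ℝ), Q k v c →
      ‖B p k v - B p' k v‖ ≤ b₁ * dist p p' * c)
    (hl : ∀ p p', p ∈ ball → p' ∈ ball → ∀ k, k < N → ∀ (u : E k) (v : F k) (c : ℝ),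
      ‖u‖ ≤ r → Q k v c → c ≤ r →
        Q (k + 1) (S p k u v - S p' k u v) (l₁ * dist p p' * max ‖u‖ c))
    (hm : ∀ h h' : E 0, ‖h‖ ≤ ρ → ‖h'‖ ≤ ρ → Q 0 (y₀ h - y₀ h') (m₀ * ‖h - h'‖)) :
    ∃ h : E 0, ‖h‖ ≤ ρ ∧ ∃ x : ∀ k, E k,
      IsTunedQ N (A (qmap h)) (B (qmap h)) (S (qmap h)) (y₀ h) x ∧
        InTubeQ N η ε Q (S (qmap h)) (y₀ h) x ∧ x 0 = h := by
  refine exists_isTunedQ_initial_eq_of_finiteDimensional (A := fun h => A (qmap h))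
    (B := fun h => B (qmap h)) (S := fun h => S (qmap h)) (y₀ := y₀)
    (a₀ := a₁ * Lq) (b₀ := b₁ * Lq) (l₀ := l₁ * Lq) (m₀ := m₀) (c₀ := c₀)
    hQ hη hη1 hα hβ hκ₁ hκ₂ hκ hε hεr hερ (mul_nonneg ha1 hLq) (mul_nonneg hb1 hLq)
    (mul_nonneg hl1 hLq) hc₀ (fun h hh => hT _ (hmaps h hh)) hy₀ ?_ ?_ ?_ hm
  · -- `A`
    intro h h' hh hh' k hk w
    calc ‖(A (qmap h) k).symm w - (A (qmap h') k).symm w‖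
        ≤ a₁ * dist (qmap h) (qmap h') * ‖w‖ := ha _ _ (hmaps h hh) (hmaps h' hh') k hk w
      _ ≤ a₁ * (Lq * ‖h - h'‖) * ‖w‖ :=
          mul_le_mul_of_nonneg_right (mul_le_mul_of_nonneg_left (hlip h h' hh hh') ha1) (norm_nonneg _)
      _ = a₁ * Lq * ‖h - h'‖ * ‖w‖ := by ring
  · -- `B`
    intro h h' hh hh' k hk v c hv
    have hc : 0 ≤ c := hQnn k hk v c hv
    calc ‖B (qmap h) k v - B (qmap h') k v‖
        ≤ b₁ * dist (qmap h) (qmap h') * c := hb _ _ (hmaps h hh) (hmaps h' hh') k hk v c hv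
      _ ≤ b₁ * (Lq * ‖h - h'‖) * c :=
          mul_le_mul_of_nonneg_right (mul_le_mul_of_nonneg_left (hlip h h' hh hh') hb1) hc
      _ = b₁ * Lq * ‖h - h'‖ * c := by ring
  · -- `S`
    intro h h' hh hh' k hk u v c hu hv hc
    have hmax : 0 ≤ max ‖u‖ c := le_max_of_le_left (norm_nonneg _)
    have h1 := hl _ _ (hmaps h hh) (hmaps h' hh') k hk u v c hu hv hc
    refine hQ.mono (k + 1) _ _ _ h1 ?_
    calc l₁ * dist (qmap h) (qmap h') * max ‖u‖ c
        ≤ l₁ * (Lq * ‖h - h'‖) * max ‖u‖ c :=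
          mul_le_mul_of_nonneg_right (mul_le_mul_of_nonneg_left (hlip h h' hh hh') hl1) hmax
      _ = l₁ * Lq * ‖h - h'‖ * max ‖u‖ c := by ring

end parametrised

end RGFlow

end Literature.Dynamics.Hyperbolic

end
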